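import Summits.QuantumAdvantage.QuantumAdvantage.Theorems.CubicForrelationNearExactIsExactTwelveLevelFive932Dead
import Summits.QuantumAdvantage.QuantumAdvantage.Theorems.CubicForrelationNearExactIsExactTwelveLevelSixBoth932

/-!
# Crux `CubicForrelation.NearExactIsExact` (stmt-QuantumAdvantage-14043) — n = 12: in the window `932/1024 ≤ Φ < 59/64` one side is TYPE O with
  base set `960` and the other side is at Ax level `≥ 6` (consolidated status of the rung `233/256`)

Certificate seat `b2b-cforr-cert` (gen 18).  HONEST FRAMING: a kernel-checked REDUCTION (standard axioms) for the single undecided value `932/1024` of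
`θ₁₂` above `57/64`: it does NOT decide whether `932/1024` is attained — that is now EQUIVALENT to the existence of a "T1 pair" (type O, base 960)
× (level ≥ 6), excluded on paper by Kasami–Tokura's normal form (which violates the 5-flat congruence `to18_typeO_E960_flat5_affine`) but not in
the tree.  NOT summit progress.

THEOREM `tw19_window_932_typeO`: cubic `f, g : 𝔽₂¹² → 𝔽₂` with `932/1024 ≤ Φ(f,g) < 59/64`.  Then, up to swapping `f` and `g`: `W_g = 16u` with
some `u(x)` odd (type O), the base set `E = {x : [u/2 odd] = [u/4 odd]}` has exactly `960` points, and `W_f ∈ 64ℤ`.  Assembly of: type O ⇒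
base `960` (`to18_typeO_ge932_E960`) and partner at level `≥ 6` (`to18_typeO_E960_partner_even`); no level-5 side (`tw19_levelFive_932_false`, this
generation); no level-≥6 × level-≥6 pair (`tw18_levelSix_both_932_false`).

References: Kasami–Tokura (1970); MacWilliams–Sloane (1977) Ch. 13, 15; C. Carlet (2021) §4.1, §5.2.  Everything below is proved from Mathlib and
the tree; axioms are the standard three.
-/

set_option linter.dupNamespace false -- D-0017: single-problem summit ⇒ `QuantumAdvantage.QuantumAdvantage` by design

noncomputable section

namespace Summit.QuantumAdvantage.QuantumAdvantage.Theorems.CubicForrelation.NearExactIsExact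

open Finset
open Literature.Computability.QuantumComplexity
open Literature.Computability.QuantumComplexity.DerivativeWalsh (W)

/-- **The window `932/1024 ≤ Φ < 59/64` on 12 bits is populated only by (type O, base 960) × (level ≥ 6) pairs** (up to swapping the two
functions).  Finite-slice statement; no new value of `θ₁₂`; NOT summit progress. [this work] -/
theorem tw19_window_932_typeO (f g : (Fin (6 + 6) → Bool) → Bool) (hf : IsDegLeFun 3 f) (hg : IsDegLeFun 3 g)
    (hlo : (932 / 1024 : ℝ) ≤ forrelation f g) (hhi : forrelation f g < 59 / 64) :
    (∃ u : (Fin (6 + 6) → Bool) → ℤ, (∀ x, W (fun y => signOf (g y)) x = (2 : ℝ) ^ 4 * (u x : ℝ)) ∧ (∃ x, Odd (u x)) ∧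
        #(univ.filter fun x : Fin (6 + 6) → Bool => (Odd (u x / 2) ↔ Odd (u x / 2 / 2))) = 960 ∧
        ∃ w : (Fin (6 + 6) → Bool) → ℤ, ∀ y, W (fun x => signOf (f x)) y = (2 : ℝ) ^ 6 * (w y : ℝ)) ∨
    (∃ u : (Fin (6 + 6) → Bool) → ℤ, (∀ y, W (fun x => signOf (f x)) y = (2 : ℝ) ^ 4 * (u y : ℝ)) ∧ (∃ y, Odd (u y)) ∧
        #(univ.filter fun y : Fin (6 + 6) → Bool => (Odd (u y / 2) ↔ Odd (u y / 2 / 2))) = 960 ∧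
        ∃ w : (Fin (6 + 6) → Bool) → ℤ, ∀ x, W (fun y => signOf (g y)) x = (2 : ℝ) ^ 6 * (w x : ℝ)) := by
  have hΦ' : forrelation g f = forrelation f g := by
    rw [Summit.QuantumAdvantage.QuantumAdvantage.Theorems.SignedCubicForrelationNotPrBPP.Negative.HalfQuad.forrelation_comm]
  have hlo' : (932 / 1024 : ℝ) ≤ forrelation g f := by rw [hΦ']; exact hlo
  obtain ⟨ug, hug⟩ := tw_base (n := 6 + 6) g hg 4 (by norm_num)
  obtain ⟨uf, huf⟩ := tw_base (n := 6 + 6) f hf 4 (by norm_num)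
  by_cases hgO : ∃ x, Odd (ug x)
  · -- `g` type O: base `960`, partner at level `≥ 6`
    left
    have hE := to18_typeO_ge932_E960 f g hf hg ug hug hgO hlo
    obtain ⟨h1, h2⟩ := to18_typeO_E960_partner_even f g hg ug hug hgO hE hlo uf huf
    have huf5 := tw_level_up (j := 4) f uf huf h1
    exact ⟨ug, hug, hgO, hE, fun y => uf y / 2 / 2, tw_level_up (j := 5) f (fun y => uf y / 2) huf5 h2⟩
  · push Not at hgO
    have hug5 := tw_level_up (j := 4) g ug hug hgO
    -- `g` is not at level 5
    have hg5 : ∀ x, ¬ Odd (ug x / 2) := fun x hx => tw19_levelFive_932_false f g hf hg (fun x => ug x / 2) hug5 ⟨x, hx⟩ hlo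
    have hug6 := tw_level_up (j := 5) g (fun x => ug x / 2) hug5 hg5
    by_cases hfO : ∃ y, Odd (uf y)
    · -- `f` type O: the symmetric configuration
      right
      have hE := to18_typeO_ge932_E960 g f hg hf uf huf hfO hlo'
      exact ⟨uf, huf, hfO, hE, fun x => ug x / 2 / 2, hug6⟩
    · push Not at hfO
      have huf5 := tw_level_up (j := 4) f uf huf hfO
      have hf5 : ∀ y, ¬ Odd (uf y / 2) := fun y hy => tw19_levelFive_932_false g f hg hf (fun y => uf y / 2) huf5 ⟨y, hy⟩ hlo'
      have huf6 := tw_level_up (j := 5) f (fun y => uf y / 2) huf5 hf5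
      exact (tw18_levelSix_both_932_false f g hf hg (fun x => ug x / 2 / 2) hug6 (fun y => uf y / 2 / 2) huf6 hlo hhi).elim

/-- **Packaging at `Fin 12`**: a cubic pair on 12 bits with `932/1024 ≤ Φ < 59/64` has a type-O side (`W = 16u`, `u` odd somewhere) with base set
of size `960` whose partner has `W ∈ 64ℤ`.  (By `isolation_twelve_gt_932`, `Φ` is then exactly `932/1024`.) [this work] -/
theorem window_932_typeO_twelve : ∀ f g : (Fin 12 → Bool) → Bool, IsDegLeFun 3 f → IsDegLeFun 3 g →
    (932 / 1024 : ℝ) ≤ forrelation f g → forrelation f g < 59 / 64 →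
    ∃ (a b : (Fin 12 → Bool) → Bool) (u w : (Fin 12 → Bool) → ℤ), ((a = f ∧ b = g) ∨ (a = g ∧ b = f)) ∧
      (∀ x, W (fun y => signOf (b y)) x = 16 * (u x : ℝ)) ∧ (∃ x, Odd (u x)) ∧
      #(univ.filter fun x : Fin 12 → Bool => (Odd (u x / 2) ↔ Odd (u x / 2 / 2))) = 960 ∧
      (∀ y, W (fun x => signOf (a x)) y = 64 * (w y : ℝ)) := by
  intro f g hf hg hlo hhi
  rcases tw19_window_932_typeO f g hf hg hlo hhi with ⟨u, hu, hodd, hE, w, hw⟩ | ⟨u, hu, hodd, hE, w, hw⟩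
  · exact ⟨f, g, u, w, Or.inl ⟨rfl, rfl⟩, fun x => (hu x).trans (by norm_num), hodd, hE, fun y => (hw y).trans (by norm_num)⟩
  · exact ⟨g, f, u, w, Or.inr ⟨rfl, rfl⟩, fun x => (hu x).trans (by norm_num), hodd, hE, fun y => (hw y).trans (by norm_num)⟩

end Summit.QuantumAdvantage.QuantumAdvantage.Theorems.CubicForrelation.NearExactIsExact

end
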